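import Mathlib
import HarnessLib

/-!
# Burgers-tube heredity: the SHARP one-tube strain constant `s(x) ≤ 3/20`

HONEST FRAMING (cell `ns-blowup`, seat `ns-blowup-instab2`; human ruling D-0035): nothing here is a
claim about Navier–Stokes blow-up. WHAT THIS IS NOT: not dynamics of any real flow; it is the
elementary real analysis behind `HOME/instab2/HEREDITY-P3.md` LEMMA P3-S (B), sharpening the kernel
constant of `BurgersTubeHeredity.lean` (p403782: `oseenStrain_le`, `s ≤ √2/4 < 0.36`) to the census
value: the in-plane rate of strain of a Gaussian (Lamb–Oseen/Burgers) core of peak vorticity `ω₀` at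
radius `r = x·a` is `ω₀ · s(x)`, `s(x) = (1 − (1 + x²)e^{−x²})/(2x²)`, and here we prove

  `1 − (1 + y) e^{−y} ≤ (3/10)·y` for all `y ≥ 0`, hence `s(x) ≤ 3/20 = 0.15` for all `x`

(numerically `max s = 0.1492` at `x = 1.339`, so the constant is sharp to two digits; the true
minimum of `h(y) = (3/10)y − 1 + (1+y)e^{−y}` on `[0, ∞)` is `0.0028` at `y = 1.78`).

Proof architecture (all in the kernel): with `ψ(y) = y e^{−y}` one has `h′ = 3/10 − ψ` and
`ψ′ = (1 − y)e^{−y}`, so `ψ` increases on `[0,1]` and decreases on `[1,∞)`. On `[0,1]` the mean value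
theorem gives `h(y) ≥ min(h(0), h(1)) = min(0, 2/e − 7/10) ≥ 0`. On `[1, 10/3]` the mean value theorem
from the near-critical point `y₀ = 1.78` gives the tangent bound `h(y) ≥ h(y₀) + h′(y₀)(y − y₀)` read
with ONE certified number, `e^{0.89} ≤ 1522/625` (from `Real.exp_bound'`, eight Taylor terms), i.e.
`e^{−1.78} ≥ 390625/2316484`; beyond `10/3` the bound is trivial. A single Gaussian tube therefore
offers strain at most `0.15·ω₀` anywhere (two tubes: `≤ 0.30·ω₀`), against the marginal schedule's
child-site demand `σ* = ω₀` — the STRAIN half of heredity costs the constant `θ ≤ 0.15` per tube, as the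
memo's census words say (`HEREDITY-P3.md` (B)/(E), planner l.690/l.743).

Mathlib only. LABEL: MODEL/kinematic bookkeeping; the fluid reading is in the memo.
-/

namespace Summit.NavierStokesRegularity.FluidComputer.BurgersTubeStrainSharp

open Real Set

/-! ### Derivatives of `ψ(y) = y e^{−y}` and of the comparison function `h` -/

/-- `ψ(y) = y e^{−y}` has derivative `(1 − y)e^{−y}`. -/
theorem hasDerivAt_mul_exp_neg (y : ℝ) :
    HasDerivAt (fun t : ℝ => t * Real.exp (-t)) ((1 - y) * Real.exp (-y)) y := by
  have hb : HasDerivAt (fun t : ℝ => Real.exp (-t)) (-Real.exp (-y)) y := by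
    have h := (hasDerivAt_neg y).exp
    simpa using h
  have h := (hasDerivAt_id y).mul hb
  exact h.congr_deriv (by simp; ring)

/-- The comparison function `h(y) = (3/10)y − 1 + (1+y)e^{−y}` has derivative `3/10 − y e^{−y}`. -/
theorem hasDerivAt_cmp (y : ℝ) :
    HasDerivAt (fun t : ℝ => 3 / 10 * t - 1 + (1 + t) * Real.exp (-t))
      (3 / 10 - y * Real.exp (-y)) y := by
  have h1 : HasDerivAt (fun t : ℝ => 3 / 10 * t - 1) (3 / 10) y := by
    simpa using ((hasDerivAt_id y).const_mul (3 / 10 : ℝ)).sub_const 1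
  have ha : HasDerivAt (fun t : ℝ => 1 + t) 1 y := by
    simpa using (hasDerivAt_id y).const_add 1
  have hb : HasDerivAt (fun t : ℝ => Real.exp (-t)) (-Real.exp (-y)) y := by
    have h := (hasDerivAt_neg y).exp
    simpa using h
  have h2 := ha.mul hb
  exact (h1.add h2).congr_deriv (by ring)

/-- `ψ` is increasing on `[0, 1]` (`ψ′ = (1−y)e^{−y} ≥ 0` there). -/
theorem mul_exp_neg_monotoneOn : MonotoneOn (fun t : ℝ => t * Real.exp (-t)) (Icc 0 1) := by
  apply monotoneOn_of_deriv_nonneg (convex_Icc 0 1)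
    (by fun_prop : Continuous fun t : ℝ => t * Real.exp (-t)).continuousOn
  · intro x _
    exact (hasDerivAt_mul_exp_neg x).differentiableAt.differentiableWithinAt
  · intro x hx
    rw [interior_Icc] at hx
    rw [(hasDerivAt_mul_exp_neg x).deriv]
    exact mul_nonneg (by linarith [hx.2]) (Real.exp_pos _).le

/-- `ψ` is decreasing on `[1, ∞)` (`ψ′ = (1−y)e^{−y} ≤ 0` there). -/
theorem mul_exp_neg_antitoneOn : AntitoneOn (fun t : ℝ => t * Real.exp (-t)) (Ici 1) := by
  apply antitoneOn_of_deriv_nonpos (convex_Ici 1)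
    (by fun_prop : Continuous fun t : ℝ => t * Real.exp (-t)).continuousOn
  · intro x _
    exact (hasDerivAt_mul_exp_neg x).differentiableAt.differentiableWithinAt
  · intro x hx
    rw [interior_Ici] at hx
    have hx' : 1 < x := hx
    rw [(hasDerivAt_mul_exp_neg x).deriv]
    exact mul_nonpos_of_nonpos_of_nonneg (by linarith) (Real.exp_pos _).le

/-! ### The one certified number: `e^{0.89} ≤ 1522/625`, i.e. `e^{−1.78} ≥ 390625/2316484` -/

/-- `e^{89/100} ≤ 1522/625 = 2.4352` (eight Taylor terms plus the Lagrange tail, `Real.exp_bound'`;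
true value `2.43513`). -/
theorem exp_089_le : Real.exp (89 / 100) ≤ 1522 / 625 := by
  calc Real.exp (89 / 100)
      ≤ (∑ m ∈ Finset.range 8, (89 / 100 : ℝ) ^ m / m.factorial) +
          (89 / 100 : ℝ) ^ 8 * (8 + 1) / (Nat.factorial 8 * 8) :=
        Real.exp_bound' (by norm_num) (by norm_num) (by norm_num)
    _ ≤ 1522 / 625 := by
        norm_num [Finset.sum_range_succ, Nat.factorial]

/-- `e^{−178/100} ≥ (625/1522)² = 390625/2316484 ≈ 0.168628` (true value `0.168638`). -/
theorem exp_neg_178_ge : (390625 / 2316484 : ℝ) ≤ Real.exp (-(178 / 100)) := by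
  have hpos : 0 < Real.exp (89 / 100) := Real.exp_pos _
  have hinv : (625 / 1522 : ℝ) ≤ (Real.exp (89 / 100))⁻¹ := by
    rw [le_inv_comm₀ (by norm_num) hpos]
    calc Real.exp (89 / 100) ≤ 1522 / 625 := exp_089_le
      _ = (625 / 1522 : ℝ)⁻¹ := by norm_num
  have h2 : Real.exp (-(178 / 100)) = (Real.exp (89 / 100))⁻¹ ^ 2 := by
    rw [← Real.exp_neg, ← Real.exp_nat_mul]
    norm_num
  rw [h2]
  calc (390625 / 2316484 : ℝ) = (625 / 1522) ^ 2 := by norm_num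
    _ ≤ (Real.exp (89 / 100))⁻¹ ^ 2 := pow_le_pow_left₀ (by norm_num) hinv 2

/-! ### `h ≥ 0` on `[1, ∞)`: tangent bound from `y₀ = 1.78` by the mean value theorem -/

/-- On `[1, ∞)`: `(3/10)y − 1 + (1+y)e^{−y} ≥ 0`. For `y ≥ 10/3` this is trivial; on `[1, 10/3]` the
mean value theorem between `y` and `y₀ = 178/100`, with `ψ` decreasing on `[1,∞)`, gives
`h(y) ≥ h(y₀) + h′(y₀)(y − y₀)`, and the right-hand side is `≥ 0.0025` by the certified value of
`e^{−1.78}` (`h(y₀) ≥ 0.0028`, `−0.00018 ≤ h′(y₀) < 0`). -/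
theorem cmp_nonneg_of_one_le {y : ℝ} (hy : 1 ≤ y) :
    0 ≤ 3 / 10 * y - 1 + (1 + y) * Real.exp (-y) := by
  by_cases hbig : 10 / 3 ≤ y
  · have : 0 ≤ (1 + y) * Real.exp (-y) := by positivity
    linarith
  have hbig' : y < 10 / 3 := lt_of_not_ge hbig
  have hL := exp_neg_178_ge
  have hcont : Continuous fun t : ℝ => 3 / 10 * t - 1 + (1 + t) * Real.exp (-t) := by fun_prop
  -- value at y₀ is ≥ 0.0028
  have hy0 : (0 : ℝ) ≤ 3 / 10 * (178 / 100) - 1 + (1 + 178 / 100) * Real.exp (-(178 / 100)) := by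
    linarith
  rcases lt_trichotomy y (178 / 100) with hlt | heq | hgt
  · -- 1 ≤ y < y₀: the slope on [y, y₀] is ≤ 0, so h y ≥ h y₀ ≥ 0
    obtain ⟨ξ, hξ, hslope⟩ := exists_hasDerivAt_eq_slope
      (fun t : ℝ => 3 / 10 * t - 1 + (1 + t) * Real.exp (-t)) (fun t => 3 / 10 - t * Real.exp (-t))
      hlt hcont.continuousOn (fun t _ => hasDerivAt_cmp t)
    have hψ : (178 / 100 : ℝ) * Real.exp (-(178 / 100)) ≤ ξ * Real.exp (-ξ) :=
      mul_exp_neg_antitoneOn (mem_Ici.mpr (by linarith [hξ.1])) (mem_Ici.mpr (by norm_num)) hξ.2.le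
    have hneg : 3 / 10 - ξ * Real.exp (-ξ) ≤ 0 := by linarith
    have hd : 0 < 178 / 100 - y := by linarith
    have hdiff : (3 / 10 * (178 / 100) - 1 + (1 + 178 / 100) * Real.exp (-(178 / 100))) -
        (3 / 10 * y - 1 + (1 + y) * Real.exp (-y)) ≤ 0 := by
      have h := hslope ▸ hneg
      rwa [div_nonpos_iff, or_iff_right (by intro h'; linarith [h'.2]), and_iff_left hd.le] at h
    linarith
  · subst heq; exact hy0
  · -- y₀ < y < 10/3: the slope on [y₀, y] is ≥ h′(y₀) ≥ 3/10 − 1.78·e^{−1.78}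
    obtain ⟨ξ, hξ, hslope⟩ := exists_hasDerivAt_eq_slope
      (fun t : ℝ => 3 / 10 * t - 1 + (1 + t) * Real.exp (-t)) (fun t => 3 / 10 - t * Real.exp (-t))
      hgt hcont.continuousOn (fun t _ => hasDerivAt_cmp t)
    have hψ : ξ * Real.exp (-ξ) ≤ (178 / 100 : ℝ) * Real.exp (-(178 / 100)) :=
      mul_exp_neg_antitoneOn (mem_Ici.mpr (by norm_num)) (mem_Ici.mpr (by linarith [hξ.1])) hξ.1.le
    have hd : 0 < y - 178 / 100 := by linarith
    -- h y − h y₀ = h′(ξ)(y − y₀) ≥ A (y − y₀) with A := 3/10 − 1.78 e^{−1.78} ≤ 0, and y − y₀ ≤ 10/3 − y₀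
    set A : ℝ := 3 / 10 - 178 / 100 * Real.exp (-(178 / 100)) with hA
    have hA_nonpos : A ≤ 0 := by rw [hA]; linarith
    have hdiff : (3 / 10 * y - 1 + (1 + y) * Real.exp (-y)) -
        (3 / 10 * (178 / 100) - 1 + (1 + 178 / 100) * Real.exp (-(178 / 100))) =
          (3 / 10 - ξ * Real.exp (-ξ)) * (y - 178 / 100) := by
      rw [hslope, div_mul_cancel₀ _ hd.ne']
    have h1 : A * (y - 178 / 100) ≤ (3 / 10 - ξ * Real.exp (-ξ)) * (y - 178 / 100) :=
      mul_le_mul_of_nonneg_right (by rw [hA]; linarith) hd.le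
    have h2 : A * (10 / 3 - 178 / 100) ≤ A * (y - 178 / 100) :=
      mul_le_mul_of_nonpos_left (by linarith) hA_nonpos
    have h3 : (0 : ℝ) ≤ 3 / 10 * (178 / 100) - 1 + (1 + 178 / 100) * Real.exp (-(178 / 100)) +
        A * (10 / 3 - 178 / 100) := by
      rw [hA]; linarith
    linarith

/-! ### `h ≥ 0` on `[0, 1]`: rise-then-fall by the mean value theorem -/

/-- `h(1) = 2/e − 7/10 > 0` (needs only `e < 2.72`). -/
theorem cmp_one_pos : (0 : ℝ) < 3 / 10 * 1 - 1 + (1 + 1) * Real.exp (-1) := by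
  have he : Real.exp 1 < 2.7182818286 := Real.exp_one_lt_d9
  have hpos : 0 < Real.exp 1 := Real.exp_pos 1
  have hinv : Real.exp (-1) = (Real.exp 1)⁻¹ := Real.exp_neg 1
  have hlow : (0.36 : ℝ) < (Real.exp 1)⁻¹ := by
    rw [lt_inv_comm₀ (by norm_num) hpos]
    calc Real.exp 1 < 2.7182818286 := he
      _ < (0.36 : ℝ)⁻¹ := by norm_num
  rw [hinv]
  linarith

/-- On `[0, 1]`: `(3/10)y − 1 + (1+y)e^{−y} ≥ 0`. With `ψ` increasing on `[0,1]`, either `ψ(y) ≤ 3/10`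
and then `h′ ≥ 0` on `[0, y]` so `h(y) ≥ h(0) = 0`, or `ψ(y) > 3/10` and then `h′ ≤ 0` on `[y, 1]` so
`h(y) ≥ h(1) > 0` (mean value theorem both times). -/
theorem cmp_nonneg_of_le_one {y : ℝ} (hy0 : 0 ≤ y) (hy1 : y ≤ 1) :
    0 ≤ 3 / 10 * y - 1 + (1 + y) * Real.exp (-y) := by
  have hcont : Continuous fun t : ℝ => 3 / 10 * t - 1 + (1 + t) * Real.exp (-t) := by fun_prop
  by_cases hψ : y * Real.exp (-y) ≤ 3 / 10
  · rcases eq_or_lt_of_le hy0 with h0 | hpos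
    · subst h0; simp
    · obtain ⟨ξ, hξ, hslope⟩ := exists_hasDerivAt_eq_slope
        (fun t : ℝ => 3 / 10 * t - 1 + (1 + t) * Real.exp (-t)) (fun t => 3 / 10 - t * Real.exp (-t))
        hpos hcont.continuousOn (fun t _ => hasDerivAt_cmp t)
      have hm : ξ * Real.exp (-ξ) ≤ y * Real.exp (-y) :=
        mul_exp_neg_monotoneOn ⟨hξ.1.le, by linarith [hξ.2]⟩ ⟨hy0, hy1⟩ hξ.2.le
      have hnn : 0 ≤ 3 / 10 - ξ * Real.exp (-ξ) := by linarith
      have h := hslope ▸ hnn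
      rw [sub_zero] at h
      have h' : 0 ≤ (3 / 10 * y - 1 + (1 + y) * Real.exp (-y)) -
          (3 / 10 * 0 - 1 + (1 + 0) * Real.exp (-0)) := by
        have := mul_nonneg h hpos.le
        rwa [div_mul_cancel₀ _ hpos.ne'] at this
      simpa using h'
  · have hψ' : 3 / 10 < y * Real.exp (-y) := lt_of_not_ge hψ
    rcases eq_or_lt_of_le hy1 with h1 | hlt
    · subst h1; exact cmp_one_pos.le
    · obtain ⟨ξ, hξ, hslope⟩ := exists_hasDerivAt_eq_slope
        (fun t : ℝ => 3 / 10 * t - 1 + (1 + t) * Real.exp (-t)) (fun t => 3 / 10 - t * Real.exp (-t))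
        hlt hcont.continuousOn (fun t _ => hasDerivAt_cmp t)
      have hm : y * Real.exp (-y) ≤ ξ * Real.exp (-ξ) :=
        mul_exp_neg_monotoneOn ⟨hy0, hy1⟩ ⟨by linarith [hξ.1], hξ.2.le⟩ hξ.1.le
      have hnp : 3 / 10 - ξ * Real.exp (-ξ) ≤ 0 := by linarith
      have hd : 0 < 1 - y := by linarith
      have h := hslope ▸ hnp
      have h' : (3 / 10 * 1 - 1 + (1 + 1) * Real.exp (-1)) -
          (3 / 10 * y - 1 + (1 + y) * Real.exp (-y)) ≤ 0 := by
        have := mul_nonpos_of_nonpos_of_nonneg h hd.le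
        rwa [div_mul_cancel₀ _ hd.ne'] at this
      linarith [cmp_one_pos]

/-! ### The sharp defect bound and the strain constant `3/20` -/

/-- **Sharp defect bound:** `1 − (1+y)e^{−y} ≤ (3/10)·y` for all `y ≥ 0` (equality approached to
within `1 %` at `y ≈ 1.78`). -/
theorem oseenDefect_le_three_tenths {y : ℝ} (hy : 0 ≤ y) :
    1 - (1 + y) * Real.exp (-y) ≤ 3 / 10 * y := by
  rcases le_total y 1 with h | h
  · linarith [cmp_nonneg_of_le_one hy h]
  · linarith [cmp_nonneg_of_one_le h]

/-- **LEMMA P3-S, sharp kernel form (HEREDITY-P3 (B)):** `s(x) ≤ 3/20 = 0.15` for every `x` — a single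
Gaussian tube of peak vorticity `ω₀` imposes in-plane strain at most `0.15·ω₀` at any point
(numerical maximum `0.1492·ω₀` at `r = 1.339a`), against the marginal schedule's child-site demand
`σ* = ω₀`: the strain half of heredity costs the constant `θ ≤ 0.15` per tube, located off the core. -/
theorem oseenStrain_le_sharp (x : ℝ) :
    (1 - (1 + x ^ 2) * Real.exp (-x ^ 2)) / (2 * x ^ 2) ≤ 3 / 20 := by
  by_cases hx : x = 0
  · subst hx; norm_num
  · have hpos : 0 < 2 * x ^ 2 := by positivity
    rw [div_le_iff₀ hpos]
    have h := oseenDefect_le_three_tenths (sq_nonneg x)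
    have : Real.exp (-x ^ 2) = Real.exp (-(x ^ 2)) := by ring_nf
    linarith

/-- Two tubes (strain tensors add at most in operator norm): the normalised strain two equal Gaussian
tubes can impose anywhere is `≤ 0.30` (memo: co-rotating pair optimum `≈ 0.30·ω₀` at `D ≈ 2.5–3a`). -/
theorem two_oseenStrain_le_sharp (x₁ x₂ : ℝ) :
    (1 - (1 + x₁ ^ 2) * Real.exp (-x₁ ^ 2)) / (2 * x₁ ^ 2) +
      (1 - (1 + x₂ ^ 2) * Real.exp (-x₂ ^ 2)) / (2 * x₂ ^ 2) ≤ 3 / 10 := by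
  have h1 := oseenStrain_le_sharp x₁
  have h2 := oseenStrain_le_sharp x₂
  linarith

end Summit.NavierStokesRegularity.FluidComputer.BurgersTubeStrainSharp
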